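import Summits.QuantumFields.YangMills.Theorems.ColdBoxAllGroupsOneScaleDefs
import Summits.QuantumFields.YangMills.Theorems.WeakCouplingRatesColdBoxDirichletPosDef
import Summits.QuantumFields.YangMills.Theorems.AllWindowsColdBoxPiMultivariateGaussianHypercontractivity
import Summits.QuantumFields.YangMills.Theorems.AllWindowsColdBoxDirFreeVarLinear
import Summits.QuantumFields.YangMills.Theorems.AllWindowsColdBoxTiltedCovPrelims
import Literature.Probability.Distributions.MultivariateGaussianWick
import Mathlib.Probability.Distributions.Gaussian.HasGaussianLaw.Independence
import Mathlib.Probability.Independence.Integration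
import HarnessLib

/-!
# LINE-17 «hypercontractive second-order tilt expansion» on crux `AllWindowsColdBox.BoxMidWindowsSU22` (stmt-QuantumFields-24003):
# the coordinate Gaussian process of `γ = gaussD H D`

The instance of the abstract Wick machinery that STUB-PLAN-E (planner ym-idea-2 g15) §2 E(1)–E(4) and §5 (F) need: the coordinates
`(a, e) ↦ (t a)_e` (`a : Fin D` a colour, `e : DirFree H` a free Dirichlet edge) of `t ∼ gaussD H D = boxDirichlet H ^{⊗D}` form a CENTRED
GAUSSIAN PROCESS (Mathlib `IsGaussianProcess`) with two-point function `E[(t a)_e (t b)_f] = δ_{ab} (Q_D⁻¹)_{ef}` — exactly the hypotheses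
`hX`, `h0` and the covariance `C = δ ⊗ Q_D⁻¹` of the tree's `…AllWindowsColdBox.CubicChaos.integral_cubicForm_sq(_le)` (E(2)) and of
`GaussianWick.integral_pow_even_eq` / `integral_prod_eq_pairingSum` (Gaussian moments for E(3), E(4), F).

* `isGaussianProcess_of_map` — transport of the Gaussian-process property along a measurable map (abstract).
* `gaussD_eq_map_piStd` — `gaussD H D` is the image of the product standard Gaussian on `Fin D × DirFree H` under the block-linear map
  `w ↦ (a ↦ √(Q_D⁻¹)·w(a,·))` (the tree's `pi_multivariateGaussian_eq_map`).
* `isGaussianProcess_coord_gaussD` — the coordinate process is Gaussian.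
* `integral_coord_gaussD` (centred: one-colour marginal), `integral_coord_mul_coord_gaussD` (`= if a = b then (Q_D⁻¹) e f else 0`: one colour =
  the tree's `integral_eval_mul_eval_multivariateGaussian`, two colours = independence of the factors of `Measure.pi`),
  `integral_coord_sq_gaussD`.
* `integral_coord_pow_even_gaussD` — `E[(t a)_e^{2k}] = (2k−1)!!·(Q_D⁻¹)_{ee}^k`, and the bounds `(Q_D⁻¹)_{ee} ≤ 16H` (stub C `inv_diag_le`),
  `|(Q_D⁻¹)_{ef}| ≤ 16H`, `E[(t a)_e^{2k}] ≤ (2k−1)!!·(16H)^k` for `H ≥ 1`.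

HONEST LABEL: helper lemmas toward the OPEN stubs E/F of one critic-PASSed line on the R2ξ″ RECORD-rung crux 24003; no stub, crux, rung or
summit is proved here; the Yang–Mills mass gap is NOT proved by this file.
-/

set_option autoImplicit false

noncomputable section

open MeasureTheory ProbabilityTheory
open scoped ENNReal Matrix MatrixOrder
open Literature.MathematicalPhysics.QuantumLattice
open Literature.MathematicalPhysics.QuantumFieldTheory
open Literature.MathematicalPhysics.QuantumFieldTheory.LatticeMaxwell
open Summit.QuantumFields.YangMills.Theorems.WeakCouplingRates
open Summit.QuantumFields.YangMills.Theorems.ColdBoxAllGroups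

namespace Summit.QuantumFields.YangMills.Theorems.AllWindowsColdBoxBoxMidLine

/-! ## Transport of the Gaussian-process property along a map -/

/-- If `t ↦ X t ∘ φ` is a Gaussian process under `Q` then `X` is a Gaussian process under `Q.map φ`. -/
theorem isGaussianProcess_of_map {T Ω Ω' : Type*} [MeasurableSpace Ω] [MeasurableSpace Ω'] {Q : Measure Ω'} {φ : Ω' → Ω}
    (hφ : Measurable φ) {X : T → Ω → ℝ} (hXm : ∀ t, Measurable (X t)) (h : IsGaussianProcess (fun t ω' => X t (φ ω')) Q) :
    IsGaussianProcess X (Q.map φ) := by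
  refine ⟨fun I => ⟨?_⟩⟩
  rw [Measure.map_map (measurable_pi_lambda (fun ω => I.restrict fun t => X t ω) fun t => hXm t.1) hφ]
  exact (h.hasGaussianLaw I).isGaussian_map

/-! ## `gaussD` as a block-linear image of the product standard Gaussian -/

section Coord

variable (H D : ℕ)

/-- `gaussD H D = ⊗_{a < D} N(0, Q_D⁻¹)` is the image of `⊗_{(a,e)} N(0,1)` under `w ↦ (a ↦ √(Q_D⁻¹)·w(a,·))` (the tree's
`pi_multivariateGaussian_eq_map`). -/
theorem gaussD_eq_map_piStd :
    gaussD H D = (Measure.pi fun _ : Fin D × DirFree H => gaussianReal 0 1).map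
      (fun w : Fin D × DirFree H → ℝ => fun a : Fin D =>
        (WithLp.toLp 2 (CFC.sqrt ((Qmat (fun e => e ∉ dirFreeEdges H) dirCorner (2 * H + 3))⁻¹) *ᵥ fun e => w (a, e)) :
          EuclideanSpace ℝ (DirFree H))) :=
  AllWindowsColdBox.GaussHypercontractivity.pi_multivariateGaussian_eq_map (κ := Fin D) _

/-- The block-linear map is measurable. -/
theorem measurable_blockSqrt :
    Measurable (fun w : Fin D × DirFree H → ℝ => fun a : Fin D =>
      (WithLp.toLp 2 (CFC.sqrt ((Qmat (fun e => e ∉ dirFreeEdges H) dirCorner (2 * H + 3))⁻¹) *ᵥ fun e => w (a, e)) :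
        EuclideanSpace ℝ (DirFree H))) := by
  have hL : Measurable fun z : DirFree H → ℝ =>
      (WithLp.toLp 2 (CFC.sqrt ((Qmat (fun e => e ∉ dirFreeEdges H) dirCorner (2 * H + 3))⁻¹) *ᵥ z) : EuclideanSpace ℝ (DirFree H)) :=
    (WithLp.measurable_toLp 2 _).comp (continuous_const.matrix_mulVec continuous_id).measurable
  exact measurable_pi_lambda _ fun a => hL.comp (measurable_pi_lambda _ fun e => measurable_pi_apply (a, e))

/-- A coordinate `t ↦ (t a)_e` is measurable (indeed continuous). -/
theorem measurable_coord (v : Fin D × DirFree H) : Measurable fun t : TSpaceD H D => WithLp.ofLp (t v.1) v.2 :=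
  ((PiLp.continuous_apply 2 (fun _ : DirFree H => ℝ) v.2).comp (continuous_apply v.1)).measurable

/-- The coordinate process of the product standard Gaussian is a Gaussian process (independent Gaussians are jointly Gaussian). -/
theorem isGaussianProcess_eval_piStd {ι : Type*} [Fintype ι] :
    IsGaussianProcess (fun (i : ι) (w : ι → ℝ) => w i) (Measure.pi fun _ : ι => gaussianReal 0 1) :=
  ⟨fun I => iIndepFun.hasGaussianLaw
    (fun i : I => (measurePreserving_eval (fun _ : ι => gaussianReal 0 1) i.1).hasLaw.hasGaussianLaw)
    ((iIndepFun_pi (μ := fun _ : ι => gaussianReal 0 1) (X := fun _ x => x) fun _ => aemeasurable_id).precomp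
      Subtype.val_injective)⟩

/-- **The coordinate process of `gaussD H D` is a Gaussian process.** -/
theorem isGaussianProcess_coord_gaussD :
    IsGaussianProcess (fun (v : Fin D × DirFree H) (t : TSpaceD H D) => WithLp.ofLp (t v.1) v.2) (gaussD H D) := by
  classical
  rw [gaussD_eq_map_piStd H D]
  refine isGaussianProcess_of_map (measurable_blockSqrt H D) (measurable_coord H D) ?_
  -- the pulled-back coordinates are linear combinations of the i.i.d. standard Gaussians
  refine (isGaussianProcess_eval_piStd (ι := Fin D × DirFree H)).of_isGaussianProcess fun v => ?_
  refine ⟨Finset.univ, ∑ f : DirFree H,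
    (CFC.sqrt ((Qmat (fun e => e ∉ dirFreeEdges H) dirCorner (2 * H + 3))⁻¹) v.2 f) •
      ContinuousLinearMap.proj (R := ℝ) (φ := fun _ : ↥(Finset.univ : Finset (Fin D × DirFree H)) => ℝ)
        ⟨(v.1, f), Finset.mem_univ _⟩, fun w => ?_⟩
  simp [Matrix.mulVec, dotProduct, Finset.restrict_def]

/-- **The coordinates are centred**: `∫ (t a)_e dγ = 0` (the one-colour marginal is `boxDirichlet H = N(0, Q_D⁻¹)`). -/
theorem integral_coord_gaussD (v : Fin D × DirFree H) : ∫ t, WithLp.ofLp (t v.1) v.2 ∂(gaussD H D) = 0 := by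
  have hsm : StronglyMeasurable (fun s : EuclideanSpace ℝ (DirFree H) => WithLp.ofLp s v.2) :=
    (PiLp.continuous_apply 2 (fun _ : DirFree H => ℝ) v.2).measurable.stronglyMeasurable
  have h := integral_map_of_stronglyMeasurable (μ := gaussD H D) (φ := Function.eval v.1) (measurable_pi_apply v.1) hsm
  rw [(measurePreserving_eval (fun _ : Fin D => boxDirichlet H) v.1).map_eq] at h
  have h' : ∫ t, WithLp.ofLp (t v.1) v.2 ∂(gaussD H D) = ∫ s, WithLp.ofLp s v.2 ∂(boxDirichlet H) := h.symm
  rw [h']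
  exact Literature.Probability.Distributions.GaussianWick.integral_eval_multivariateGaussian_zero _ v.2

/-- **The two-point function of the coordinates**: `∫ (t a)_e (t b)_f dγ = δ_{ab} (Q_D⁻¹)_{ef}`. -/
theorem integral_coord_mul_coord_gaussD (a b : Fin D) (e f : DirFree H) :
    ∫ t, WithLp.ofLp (t a) e * WithLp.ofLp (t b) f ∂(gaussD H D) =
      if a = b then ((Qmat (fun e => e ∉ dirFreeEdges H) dirCorner (2 * H + 3))⁻¹) e f else 0 := by
  classical
  split_ifs with hab
  · subst hab
    -- one colour: the marginal is `boxDirichlet H = N(0, Q_D⁻¹)`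
    have hsm : StronglyMeasurable (fun s : EuclideanSpace ℝ (DirFree H) => WithLp.ofLp s e * WithLp.ofLp s f) :=
      (((PiLp.continuous_apply 2 (fun _ : DirFree H => ℝ) e).mul
        (PiLp.continuous_apply 2 (fun _ : DirFree H => ℝ) f)).measurable).stronglyMeasurable
    have h := integral_map_of_stronglyMeasurable (μ := gaussD H D) (φ := Function.eval a) (measurable_pi_apply a) hsm
    rw [(measurePreserving_eval (fun _ : Fin D => boxDirichlet H) a).map_eq] at h
    have h' : ∫ t, WithLp.ofLp (t a) e * WithLp.ofLp (t a) f ∂(gaussD H D) =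
        ∫ s, WithLp.ofLp s e * WithLp.ofLp s f ∂(boxDirichlet H) := h.symm
    rw [h']
    exact Literature.Probability.Distributions.GaussianWick.integral_eval_mul_eval_multivariateGaussian
      (posDef_dirQmat H).inv.posSemidef e f
  · -- two colours: independence of the factors of the product measure
    have hind : IndepFun (fun t : TSpaceD H D => WithLp.ofLp (t a) e) (fun t : TSpaceD H D => WithLp.ofLp (t b) f) (gaussD H D) := by
      have h := (iIndepFun_pi (μ := fun _ : Fin D => boxDirichlet H) (X := fun _ x => x) fun _ => aemeasurable_id).indepFun hab
      exact h.comp (PiLp.continuous_apply 2 (fun _ : DirFree H => ℝ) e).measurable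
        (PiLp.continuous_apply 2 (fun _ : DirFree H => ℝ) f).measurable
    have h := hind.integral_mul_eq_mul_integral (measurable_coord H D (a, e)).aestronglyMeasurable
      (measurable_coord H D (b, f)).aestronglyMeasurable
    have h0 := integral_coord_gaussD H D (a, e)
    simp only at h0
    rw [show (fun t : TSpaceD H D => WithLp.ofLp (t a) e * WithLp.ofLp (t b) f) =
      (fun t : TSpaceD H D => WithLp.ofLp (t a) e) * (fun t : TSpaceD H D => WithLp.ofLp (t b) f) from rfl, h, h0, zero_mul]

/-- The variance of a coordinate: `∫ (t a)_e² dγ = (Q_D⁻¹)_{ee}`. -/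
theorem integral_coord_sq_gaussD (a : Fin D) (e : DirFree H) :
    ∫ t, WithLp.ofLp (t a) e ^ 2 ∂(gaussD H D) = ((Qmat (fun e => e ∉ dirFreeEdges H) dirCorner (2 * H + 3))⁻¹) e e := by
  simp_rw [sq]
  rw [integral_coord_mul_coord_gaussD, if_pos rfl]

/-- **Even moments of a coordinate** (Wick): `∫ (t a)_e^{2k} dγ = (2k−1)!!·(Q_D⁻¹)_{ee}^k`. -/
theorem integral_coord_pow_even_gaussD (a : Fin D) (e : DirFree H) (k : ℕ) :
    ∫ t, WithLp.ofLp (t a) e ^ (2 * k) ∂(gaussD H D) =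
      (((2 * k - 1).doubleFactorial : ℕ) : ℝ) * (((Qmat (fun e => e ∉ dirFreeEdges H) dirCorner (2 * H + 3))⁻¹) e e) ^ k := by
  have h := Literature.Probability.Distributions.GaussianWick.integral_pow_even_eq (isGaussianProcess_coord_gaussD H D)
    (integral_coord_gaussD H D) (a, e) k
  simp only at h
  rw [h, integral_coord_sq_gaussD]

/-- All powers of a coordinate are integrable under `γ`. -/
theorem integrable_coord_pow_gaussD (v : Fin D × DirFree H) (n : ℕ) :
    Integrable (fun t : TSpaceD H D => WithLp.ofLp (t v.1) v.2 ^ n) (gaussD H D) := by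
  have h := Literature.Probability.Distributions.GaussianWick.integrable_pow_mul_prod (isGaussianProcess_coord_gaussD H D) v n
    (∅ : Finset Unit) (fun _ => v)
  simpa using h

/-! ## Bounds: `(Q_D⁻¹)_{ee} ≤ 16H`, `|(Q_D⁻¹)_{ef}| ≤ 16H`, `E[(t a)_e^{2k}] ≤ (2k−1)!!(16H)^k` -/

variable {H}

/-- Off-diagonal entries of the covariance are dominated by the diagonal: `(Q_D⁻¹)_{ef}² ≤ (Q_D⁻¹)_{ee}(Q_D⁻¹)_{ff}` (Cauchy–Schwarz
for the Gaussian two-point function). -/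
theorem covQ_sq_le (e f : DirFree H) :
    (((Qmat (fun e => e ∉ dirFreeEdges H) dirCorner (2 * H + 3))⁻¹) e f) ^ 2 ≤
      ((Qmat (fun e => e ∉ dirFreeEdges H) dirCorner (2 * H + 3))⁻¹) e e *
        ((Qmat (fun e => e ∉ dirFreeEdges H) dirCorner (2 * H + 3))⁻¹) f f := by
  have h1 := integral_coord_mul_coord_gaussD H 1 0 0 e f
  rw [if_pos rfl] at h1
  rw [← h1, ← integral_coord_sq_gaussD H 1 0 e, ← integral_coord_sq_gaussD H 1 0 f]
  haveI := isProbabilityMeasure_gaussD H 1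
  have hX := isGaussianProcess_coord_gaussD H 1
  have h2e : MemLp (fun t : TSpaceD H 1 => WithLp.ofLp (t 0) e) 2 (gaussD H 1) := (hX.hasGaussianLaw_eval (0, e)).memLp_two
  have h2f : MemLp (fun t : TSpaceD H 1 => WithLp.ofLp (t 0) f) 2 (gaussD H 1) := (hX.hasGaussianLaw_eval (0, f)).memLp_two
  exact AllWindowsColdBoxTiltedCov.sq_integral_mul_le (fun _ => rfl) (fun _ => rfl) h2e.integrable_sq h2f.integrable_sq
    (h2e.integrable_mul h2f)

/-- `|(Q_D⁻¹)_{ef}| ≤ 16·H` for `H ≥ 1` (stub C `inv_diag_le` on the diagonal + Cauchy–Schwarz). -/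
theorem abs_covQ_le (hH : 1 ≤ H) (e f : DirFree H) :
    |((Qmat (fun e => e ∉ dirFreeEdges H) dirCorner (2 * H + 3))⁻¹) e f| ≤ 16 * (H : ℝ) := by
  have h := covQ_sq_le e f
  have he := AllWindowsColdBoxDirFreeVar.inv_diag_le hH e
  have hf := AllWindowsColdBoxDirFreeVar.inv_diag_le hH f
  have he0 : 0 ≤ ((Qmat (fun e => e ∉ dirFreeEdges H) dirCorner (2 * H + 3))⁻¹) e e := by
    rw [← integral_coord_sq_gaussD H 1 0 e]; exact integral_nonneg fun t => sq_nonneg _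
  have hf0 : 0 ≤ ((Qmat (fun e => e ∉ dirFreeEdges H) dirCorner (2 * H + 3))⁻¹) f f := by
    rw [← integral_coord_sq_gaussD H 1 0 f]; exact integral_nonneg fun t => sq_nonneg _
  have hsq : (((Qmat (fun e => e ∉ dirFreeEdges H) dirCorner (2 * H + 3))⁻¹) e f) ^ 2 ≤ (16 * (H : ℝ)) ^ 2 :=
    h.trans (by nlinarith [mul_le_mul he hf hf0 (by positivity : (0 : ℝ) ≤ 16 * H)])
  exact abs_le_of_sq_le_sq' hsq (by positivity) |>.elim (fun h1 h2 => abs_le.2 ⟨h1, h2⟩)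

/-- **Even moments are polynomial in `H`**: `∫ (t a)_e^{2k} dγ ≤ (2k−1)!!·(16H)^k` for `H ≥ 1`. -/
theorem integral_coord_pow_even_gaussD_le (hH : 1 ≤ H) (D : ℕ) (a : Fin D) (e : DirFree H) (k : ℕ) :
    ∫ t, WithLp.ofLp (t a) e ^ (2 * k) ∂(gaussD H D) ≤ (((2 * k - 1).doubleFactorial : ℕ) : ℝ) * (16 * (H : ℝ)) ^ k := by
  rw [integral_coord_pow_even_gaussD]
  have he0 : 0 ≤ ((Qmat (fun e => e ∉ dirFreeEdges H) dirCorner (2 * H + 3))⁻¹) e e := by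
    rw [← integral_coord_sq_gaussD H 1 0 e]; exact integral_nonneg fun t => sq_nonneg _
  exact mul_le_mul_of_nonneg_left (pow_le_pow_left₀ he0 (AllWindowsColdBoxDirFreeVar.inv_diag_le hH e) k) (Nat.cast_nonneg _)

end Coord

end Summit.QuantumFields.YangMills.Theorems.AllWindowsColdBoxBoxMidLine

end
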